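import Summits.CriticalPhenomena.SAWScalingLimit.Theorems.SAWLoopFugacityFlowIsingBoundaryRatioWindowRectWhisker
import HarnessLib

/-!
# Open squares, lattice lines and midpoints of sides
(line `fk-anchor-transfer`, crux `IsingBoundaryRatio`, stmt-CriticalPhenomena-10650; helper file of the stub
`windowRectPresentation_holds`)

Elementary plane bookkeeping at mesh `δ` for the non-interleaving theorem (`…WindowRectNonInterleave`):
the open unit square `openSq δ g` with lower-left corner `δ g`; frame points with both frame coordinates in
`(0, δ)` lie in the open square `quad x k` of their arrow (`framePt_mem_openSq`); points of lattice lines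
(lattice points, points of lattice edges, axis points `framePt δ (x, k) s 0`) lie in no open square; two open
squares meeting are equal; an axis point `framePt δ (x, k) s 0`, `0 < s < δ`, lies on the segment of a lattice
edge only if that edge is `x, x + e_k` (`edge_eq_of_axisPt_mem_segment`); the two squares on the two sides of
a lattice edge (`squares_of_side_eq`); and the points of the segment joining the centres of two side-adjacent
squares are in one of the two open squares or at the midpoint of the common side (`across_cases`).
[folklore]
-/

noncomputable section

open scoped Classical
open Set Complex Literature.Probability.LatticeModels Literature.Probability.LatticeModels.DiscreteRect

namespace Summit.CriticalPhenomena.SAWScalingLimit.Theorems.IsingBoundaryRatio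

namespace WindowRect

variable {δ : ℝ}

/-! ### Squares and their coordinates -/

/-- The coordinates of `dir k` and of the lower-left corner of `quad x k`, in the four cases. [folklore] -/
theorem quad_dir_cases (x : Site 2) (k : Fin 4) :
    (dir k 0 = 1 ∧ dir k 1 = 0 ∧ quad x k 0 = x 0 ∧ quad x k 1 = x 1) ∨
    (dir k 0 = 0 ∧ dir k 1 = 1 ∧ quad x k 0 = x 0 - 1 ∧ quad x k 1 = x 1) ∨
    (dir k 0 = -1 ∧ dir k 1 = 0 ∧ quad x k 0 = x 0 - 1 ∧ quad x k 1 = x 1 - 1) ∨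
    (dir k 0 = 0 ∧ dir k 1 = -1 ∧ quad x k 0 = x 0 ∧ quad x k 1 = x 1 - 1) := by
  fin_cases k
  · left; exact ⟨by decide, by decide, by simp [quad], by simp [quad]⟩
  · right; left; exact ⟨by decide, by decide, by simp [quad, dir]; ring, by simp [quad, dir]⟩
  · right; right; left; exact ⟨by decide, by decide, by simp [quad, dir]; ring, by simp [quad, dir]; ring⟩
  · right; right; right; exact ⟨by decide, by decide, by simp [quad, dir], by simp [quad, dir]; ring⟩

/-- The square across the `k`-th... : `quad x (k + 3) = quad x k + e_{k+3}` (the square on the other side of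
the edge `x, x + e_k`). [folklore] -/
theorem quad_add_three_eq (x : Site 2) (k : Fin 4) : quad x (k + 3) = quad x k + dir (k + 3) := by
  rw [Site.eq_iff_two]
  fin_cases k <;> simp [quad, dir]

/-- The square on the other side of the edge `x, x + e_k`, seen from `x + e_k`. [folklore] -/
theorem quad_add_dir_add_two (x : Site 2) (k : Fin 4) : quad (x + dir k) (k + 2) = quad x (k + 3) := by
  rw [Site.eq_iff_two]
  fin_cases k <;> simp [quad, dir]

/-- `quad x k = quad x (k + 3) + e_{k+1}`, with `e_{k+1}` written as `e_{(k+2)+3}`. [folklore] -/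
theorem quad_eq_quad_add_three_add (x : Site 2) (k : Fin 4) : quad x k = quad x (k + 3) + dir (k + 2 + 3) := by
  rw [fin4_add_two_add_three, quad_add_three_eq, add_assoc, dir_add_three, neg_add_cancel, add_zero]

/-! ### Open squares -/

/-- The open square of mesh `δ` with lower-left corner `δ g`. [folklore] -/
def openSq (δ : ℝ) (g : Site 2) : Set ℂ :=
  {z | δ * g 0 < z.re ∧ z.re < δ * (g 0 + 1) ∧ δ * g 1 < z.im ∧ z.im < δ * (g 1 + 1)}

/-- Membership in an open square, unfolded. [folklore] -/
theorem mem_openSq_iff {g : Site 2} {z : ℂ} :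
    z ∈ openSq δ g ↔ δ * g 0 < z.re ∧ z.re < δ * (g 0 + 1) ∧ δ * g 1 < z.im ∧ z.im < δ * (g 1 + 1) := Iff.rfl

/-- **A frame point with both coordinates in `(0, δ)` lies in the open square of its arrow.** [folklore] -/
theorem framePt_mem_openSq {x : Site 2} {k : Fin 4} {a b : ℝ} (ha : a ∈ Ioo 0 δ) (hb : b ∈ Ioo 0 δ) :
    framePt δ (x, k) a b ∈ openSq δ (quad x k) := by
  obtain ⟨hre, him⟩ := framePt_sub_coords (δ := δ) x k a b
  rw [mem_openSq_iff]
  rcases quad_dir_cases x k with ⟨h0, h1, q0, q1⟩ | ⟨h0, h1, q0, q1⟩ | ⟨h0, h1, q0, q1⟩ | ⟨h0, h1, q0, q1⟩ <;>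
    rw [q0, q1] <;> rw [h0, h1] at hre him <;> push_cast at hre him ⊢ <;>
    refine ⟨?_, ?_, ?_, ?_⟩ <;> nlinarith [ha.1, ha.2, hb.1, hb.2]

/-- **Two open squares with a common point are equal.** [folklore] -/
theorem eq_of_mem_openSq (hδ : 0 < δ) {g g' : Site 2} {z : ℂ} (hz : z ∈ openSq δ g) (hz' : z ∈ openSq δ g') :
    g = g' := by
  obtain ⟨a1, a2, a3, a4⟩ := hz
  obtain ⟨b1, b2, b3, b4⟩ := hz'
  have h0 : ((g 0 : ℤ) : ℝ) < g' 0 + 1 := lt_of_mul_lt_mul_left (a1.trans b2) hδ.le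
  have h0' : ((g' 0 : ℤ) : ℝ) < g 0 + 1 := lt_of_mul_lt_mul_left (b1.trans a2) hδ.le
  have h1 : ((g 1 : ℤ) : ℝ) < g' 1 + 1 := lt_of_mul_lt_mul_left (a3.trans b4) hδ.le
  have h1' : ((g' 1 : ℤ) : ℝ) < g 1 + 1 := lt_of_mul_lt_mul_left (b3.trans a4) hδ.le
  have e0 : g 0 = g' 0 := by
    have : (g 0 : ℝ) < g' 0 + 1 := h0
    have : (g' 0 : ℝ) < g 0 + 1 := h0'
    have i1 : g 0 < g' 0 + 1 := by exact_mod_cast h0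
    have i2 : g' 0 < g 0 + 1 := by exact_mod_cast h0'
    omega
  have e1 : g 1 = g' 1 := by
    have i1 : g 1 < g' 1 + 1 := by exact_mod_cast h1
    have i2 : g' 1 < g 1 + 1 := by exact_mod_cast h1'
    omega
  exact (Site.eq_iff_two).2 ⟨e0, e1⟩

/-! ### Lattice lines -/

/-- The points of the lattice lines of mesh `δ`: one coordinate is an integer multiple of `δ`. [folklore] -/
def linePts (δ : ℝ) : Set ℂ := {z | (∃ n : ℤ, z.re = δ * n) ∨ ∃ n : ℤ, z.im = δ * n}

/-- Membership in `linePts`, unfolded. [folklore] -/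
theorem mem_linePts_iff {z : ℂ} : z ∈ linePts δ ↔ (∃ n : ℤ, z.re = δ * n) ∨ ∃ n : ℤ, z.im = δ * n := Iff.rfl

/-- A multiple `δ n` strictly between `δ m` and `δ (m + 1)` is impossible. [folklore] -/
theorem false_of_mul_mem_Ioo (hδ : 0 < δ) {n m : ℤ} (h1 : δ * m < δ * n) (h2 : δ * n < δ * (m + 1)) : False := by
  have i1 : (m : ℝ) < n := lt_of_mul_lt_mul_left h1 hδ.le
  have i2 : (n : ℝ) < m + 1 := lt_of_mul_lt_mul_left h2 hδ.le
  have j1 : m < n := by exact_mod_cast i1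
  have j2 : n < m + 1 := by exact_mod_cast i2
  omega

/-- **Points of lattice lines lie in no open square.** [folklore] -/
theorem not_mem_openSq_of_mem_linePts (hδ : 0 < δ) {z : ℂ} (hz : z ∈ linePts δ) (g : Site 2) : z ∉ openSq δ g := by
  rintro ⟨a1, a2, a3, a4⟩
  rcases hz with ⟨n, hn⟩ | ⟨n, hn⟩
  · rw [hn] at a1 a2; exact false_of_mul_mem_Ioo hδ a1 a2
  · rw [hn] at a3 a4; exact false_of_mul_mem_Ioo hδ a3 a4

/-- Lattice points are on lattice lines. [folklore] -/
theorem meshPoint_mem_linePts (x : Site 2) : meshPoint δ x ∈ linePts δ :=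
  Or.inl ⟨x 0, meshPoint_re δ x⟩

/-- Axis points `framePt δ (x, k) s 0` are on lattice lines. [folklore] -/
theorem framePt_axis_mem_linePts (x : Site 2) (k : Fin 4) (s : ℝ) : framePt δ (x, k) s 0 ∈ linePts δ := by
  obtain ⟨hre, him⟩ := framePt_sub_coords (δ := δ) x k s 0
  rcases dir_apply_cases k with ⟨h0, h1⟩ | ⟨h0, h1⟩ | ⟨h0, h1⟩ | ⟨h0, h1⟩ <;> rw [h0, h1] at hre him <;>
    push_cast at hre him
  · exact Or.inr ⟨x 1, by linarith⟩
  · exact Or.inl ⟨x 0, by linarith⟩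
  · exact Or.inr ⟨x 1, by linarith⟩
  · exact Or.inl ⟨x 0, by linarith⟩

/-- Points of a lattice edge are on lattice lines. [folklore] -/
theorem mem_linePts_of_mem_edge (hδ : 0 < δ) {v : Site 2} {K : Fin 4} {z : ℂ}
    (hz : z ∈ segment ℝ (meshPoint δ v) (meshPoint δ (v + dir K))) : z ∈ linePts δ := by
  obtain ⟨t, -, rfl⟩ := exists_of_mem_edge hδ hz
  exact framePt_axis_mem_linePts v K t

/-- Points of an edge of a set of lattice edges are on lattice lines. [folklore] -/
theorem mem_linePts_of_mem_edge' (hδ : 0 < δ) {E : Finset (Sym2 (Site 2))} (hE : ∀ e ∈ E, e ∈ (zdGraph 2).edgeSet)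
    {v w : Site 2} (hvw : s(v, w) ∈ E) {z : ℂ} (hz : z ∈ segment ℝ (meshPoint δ v) (meshPoint δ w)) :
    z ∈ linePts δ := by
  have hadj : (zdGraph 2).Adj v w := by
    have := hE _ hvw
    rwa [SimpleGraph.mem_edgeSet] at this
  obtain ⟨K, rfl⟩ := exists_eq_add_dir_of_adj hadj
  exact mem_linePts_of_mem_edge hδ hz

/-! ### Axis points on lattice edges -/

/-- **An axis point `framePt δ (x, k) s 0`, `0 < s < δ`, on the closed segment of a lattice edge forces that
edge to be `x, x + e_k`.** [folklore] -/
theorem edge_eq_of_axisPt_mem_segment (hδ : 0 < δ) {x : Site 2} {k : Fin 4} {s : ℝ} (hs : s ∈ Ioo 0 δ)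
    {v w : Site 2} (hadj : (zdGraph 2).Adj v w)
    (hz : framePt δ (x, k) s 0 ∈ segment ℝ (meshPoint δ v) (meshPoint δ w)) : s(v, w) = s(x, x + dir k) := by
  have hz' : framePt δ (x, k) s 0 ∈ segment ℝ (meshPoint δ x) (meshPoint δ (x + dir k)) := by
    rw [← framePt_origin x k, ← framePt_far x k, segment_eq_image_lineMap]
    refine ⟨s / δ, ⟨div_nonneg hs.1.le hδ.le, (div_le_one hδ).2 hs.2.le⟩, ?_⟩
    rw [framePt_lineMap_fst]; congr 1; field_simp; ring
  obtain ⟨m, hm1, hm2⟩ := exists_common_endpoint hδ (zdGraph_adj_add_dir x k) hadj hz' hz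
  -- the edge `v w` seen from the common endpoint `m`
  obtain ⟨K, hE, hzK⟩ : ∃ K : Fin 4, s(v, w) = s(m, m + dir K) ∧
      framePt δ (x, k) s 0 ∈ segment ℝ (meshPoint δ m) (meshPoint δ (m + dir K)) := by
    rcases hm2 with rfl | rfl
    · obtain ⟨K, rfl⟩ := exists_eq_add_dir_of_adj hadj
      exact ⟨K, rfl, hz⟩
    · obtain ⟨K, rfl⟩ := exists_eq_add_dir_of_adj hadj.symm
      exact ⟨K, Sym2.eq_swap, by rw [segment_symm]; exact hz⟩
  obtain ⟨t, ht, hzt⟩ := exists_of_mem_edge hδ hzK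
  rw [hE]
  rcases hm1 with rfl | rfl
  · obtain ⟨rfl, -⟩ := ray_eq hs.1 ht.1 hzt.symm
    rfl
  · rw [framePt_reverse x k s 0, neg_zero] at hzt
    obtain ⟨rfl, -⟩ := ray_eq (by linarith [hs.2]) ht.1 hzt.symm
    rw [dir_add_two, ← sub_eq_add_neg, add_sub_cancel_right, Sym2.eq_swap]

/-- An axis point `framePt δ (x, k) s 0`, `0 < s < δ`, with `x, x + e_k ∉ E` lies on no edge of `E`. [folklore] -/
theorem axisPt_not_mem_edge (hδ : 0 < δ) {E : Finset (Sym2 (Site 2))} (hE : ∀ e ∈ E, e ∈ (zdGraph 2).edgeSet)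
    {x : Site 2} {k : Fin 4} (hxk : s(x, x + dir k) ∉ E) {s : ℝ} (hs : s ∈ Ioo 0 δ) {v w : Site 2}
    (hvw : s(v, w) ∈ E) (hz : framePt δ (x, k) s 0 ∈ segment ℝ (meshPoint δ v) (meshPoint δ w)) : False := by
  have hadj : (zdGraph 2).Adj v w := by
    have := hE _ hvw
    rwa [SimpleGraph.mem_edgeSet] at this
  rw [edge_eq_of_axisPt_mem_segment hδ hs hadj hz] at hvw
  exact hxk hvw

/-! ### The two squares of an edge, midpoints -/

/-- **The two squares having a given side.** If the `i`-th side of the square `b` is the edge `x, x + e_k`,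
then `b` and the square across that side are `quad x k` and `quad x (k + 3)` (in some order). [folklore] -/
theorem squares_of_side_eq {b x : Site 2} {i k : Fin 4} (h : s(corner b i, corner b i + dir i) = s(x, x + dir k)) :
    (b = quad x k ∧ b + dir (i + 3) = quad x (k + 3)) ∨ (b = quad x (k + 3) ∧ b + dir (i + 3) = quad x k) := by
  rcases Sym2.eq_iff.1 h with ⟨h1, h2⟩ | ⟨h1, h2⟩
  · rw [h1, add_right_inj] at h2
    have hik : i = k := dir_injective h2
    subst hik
    left
    refine ⟨by rw [← h1, quad_corner], ?_⟩
    rw [quad_add_three_eq, ← h1, quad_corner]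
  · rw [h1, add_assoc, add_eq_left, dir_add_dir_eq_zero_iff] at h2
    subst h2
    right
    have hb : b = quad x (k + 3) := by rw [← quad_add_dir_add_two x k, ← h1, quad_corner]
    refine ⟨hb, ?_⟩
    rw [hb, ← quad_eq_quad_add_three_add]

/-- The midpoint of the `i`-th side of the square `a` lies on that side. [folklore] -/
theorem mid_mem_segment_side (a : Site 2) (i : Fin 4) :
    framePt δ (corner a i, i) (δ / 2) 0 ∈ segment ℝ (meshPoint δ (corner a i)) (meshPoint δ (corner a i + dir i)) := by
  rw [← framePt_origin (corner a i) i, ← framePt_far (corner a i) i, segment_eq_image_lineMap]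
  refine ⟨1 / 2, ⟨by norm_num, by norm_num⟩, ?_⟩
  rw [framePt_lineMap_fst]
  congr 1
  ring

/-- **Equal midpoints, equal sides.** [folklore] -/
theorem side_eq_of_mid_eq (hδ : 0 < δ) {a b : Site 2} {i i' : Fin 4}
    (h : framePt δ (corner a i, i) (δ / 2) 0 = framePt δ (corner b i', i') (δ / 2) 0) :
    s(corner b i', corner b i' + dir i') = s(corner a i, corner a i + dir i) := by
  have hz := mid_mem_segment_side (δ := δ) b i'
  rw [← h] at hz
  exact edge_eq_of_axisPt_mem_segment hδ ⟨by positivity, by linarith⟩ (zdGraph_adj_add_dir _ _) hz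

/-! ### Segments between centres of side-adjacent squares -/

/-- **Across a side.** A point of the segment from the centre of the square `a` to the centre of the square
`a + e_{i+3}` across the `i`-th side of `a` is in the open square `a`, in the open square across, or is the
midpoint of the common side. [folklore] -/
theorem across_cases (hδ : 0 < δ) {a : Site 2} {i : Fin 4} {z : ℂ}
    (hz : z ∈ segment ℝ (framePt δ (corner a i, i) (δ / 2) (δ / 2)) (framePt δ (corner a i, i) (δ / 2) (-(δ / 2)))) :
    z ∈ openSq δ a ∨ z ∈ openSq δ (a + dir (i + 3)) ∨ z = framePt δ (corner a i, i) (δ / 2) 0 := by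
  rw [segment_symm] at hz
  obtain ⟨c, hc, rfl⟩ := exists_of_mem_segment_snd (by linarith) hz
  rcases lt_trichotomy c 0 with h | rfl | h
  · right; left
    have e : framePt δ (corner a i, i) (δ / 2) c = framePt δ (corner a i, i + 3) (-c) (δ / 2) := by
      rw [framePt_rot_three, neg_neg]
    have hc' : -c ∈ Ioo 0 δ := ⟨by linarith, by linarith [hc.1]⟩
    have hd : δ / 2 ∈ Ioo 0 δ := ⟨by positivity, by linarith⟩
    have hmem := framePt_mem_openSq (x := corner a i) (k := i + 3) hc' hd
    rwa [quad_add_three_eq, quad_corner, ← e] at hmem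
  · right; right; rfl
  · left
    have hc' : c ∈ Ioo 0 δ := ⟨h, by linarith [hc.2]⟩
    have hd : δ / 2 ∈ Ioo 0 δ := ⟨by positivity, by linarith⟩
    have hmem := framePt_mem_openSq (x := corner a i) (k := i) hd hc'
    rwa [quad_corner] at hmem

/-- A point across a side is in one of the two closed... is in the open square `a`, the open square across, or
on a lattice line. [folklore] -/
theorem across_cases' (hδ : 0 < δ) {a : Site 2} {i : Fin 4} {z : ℂ}
    (hz : z ∈ segment ℝ (framePt δ (corner a i, i) (δ / 2) (δ / 2)) (framePt δ (corner a i, i) (δ / 2) (-(δ / 2)))) :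
    z ∈ openSq δ a ∨ z ∈ openSq δ (a + dir (i + 3)) ∨ z ∈ linePts δ := by
  rcases across_cases hδ hz with h | h | rfl
  · exact Or.inl h
  · exact Or.inr (Or.inl h)
  · exact Or.inr (Or.inr (framePt_axis_mem_linePts _ _ _))

/-- **Across a side not in `E`, off the edges of `E`.** [folklore] -/
theorem across_not_mem_edge (hδ : 0 < δ) {E : Finset (Sym2 (Site 2))} (hE : ∀ e ∈ E, e ∈ (zdGraph 2).edgeSet)
    {a : Site 2} {i : Fin 4} (hne : s(corner a i, corner a i + dir i) ∉ E) {z : ℂ}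
    (hz : z ∈ segment ℝ (framePt δ (corner a i, i) (δ / 2) (δ / 2)) (framePt δ (corner a i, i) (δ / 2) (-(δ / 2))))
    {v w : Site 2} (hvw : s(v, w) ∈ E) (hz' : z ∈ segment ℝ (meshPoint δ v) (meshPoint δ w)) : False := by
  have hline := mem_linePts_of_mem_edge' hδ hE hvw hz'
  rcases across_cases hδ hz with h | h | rfl
  · exact not_mem_openSq_of_mem_linePts hδ hline _ h
  · exact not_mem_openSq_of_mem_linePts hδ hline _ h
  · exact axisPt_not_mem_edge hδ hE hne ⟨by positivity, by linarith⟩ hvw hz'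

end WindowRect

/-- **Two open squares with a common point are equal**, closed form (registered sub-goal of
stmt-CriticalPhenomena-10650). [folklore] -/
theorem windowRect_eq_of_mem_openSq : ∀ {δ : ℝ}, 0 < δ → ∀ {g g' : Site 2} {z : ℂ}, z ∈ WindowRect.openSq δ g → z ∈ WindowRect.openSq δ g' → g = g' :=
  fun hδ _ _ _ hz hz' => WindowRect.eq_of_mem_openSq hδ hz hz'

end Summit.CriticalPhenomena.SAWScalingLimit.Theorems.IsingBoundaryRatio

end
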